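import Summits.HodgeConjecture.CorCM.MumfordTateRankSeven
import Literature.AlgebraicGeometry.HodgeTheory.StablyNondegenerateProductLowDimensionFactors
import HarnessLib

/-!
# Ring 2 (cell topic `Summits/HodgeConjecture/Ring2/`; seat `lit`, gen 81, R58): the rung `dim MT(H¹X) = 7`, split shape — the Hazama binder is GONE: `X ∼ B₁^{a+1} × B₂^{b+1}` is stably nondegenerate and the Hodge conjecture holds for all its powers, UNCONDITIONALLY

HONEST FRAMING (cell `pub-hodge-ring2`, verbatim): research route conditional on HC_CM; not a corollary;
Q11.4-sentence-2 already refuted in dim ≥ 3. `HC_CM` does NOT occur in this file; Markman's theorem occurs only as the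
hypothesis it already is in case (i) of the COR-CM trichotomy (never asserted). Theorems only — no definition, no named
fact, no `sorry`; the named fact `Hazama1989_stablyNondegenerate_prod` is NOT used, asserted or restated.

PURPOSE. The COR-CM rows `Summit.HodgeConjecture.CorCM.exists_shape_and_hodge_of_ideal_pair`,
`….isStablyNondegenerate_of_ideal_pair_of_hazama` and case (iii) of `….mtRank_hodge_one_eq_seven_trichotomy`
(`CorCM/MumfordTateRankSevenSplitHodge`, `CorCM/MumfordTateRankSeven`; cell `pub-hodgecm2`, seat b27) conclude
«`X` stably nondegenerate, Hodge conjecture for all powers» for the split shape `X ∼ B₁^{a+1} × B₂^{b+1}` (two simple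
non-CM factors of dimension `≤ 2` with `dim End⁰ = dim²`, centre `ℚ`) GIVEN the named fact
`Hazama1989_stablyNondegenerate_prod` as an explicit binder. The Literature lane's R58
(`Literature.AlgebraicGeometry.HodgeTheory.IsStablyNondegenerate.prod_of_dim_le_seven`: Hazama's theorem is
UNCONDITIONAL for a second factor of dimension `≤ 7` — Albert's `d ≤ 2` below dimension `8` by arithmetic) discharges
that binder: here `dim B₂ ≤ 2 ≤ 7`, `B₂` has no factor of type IV and both factors are stably nondegenerate
(`hasNoTypeIVFactor_and_isStablyNondegenerate_of_factor`). (The lane's g79 file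
`StablyNondegenerateTimesQuaternionSurface` gives a second, shape-specific road; this file takes the dimension road.)

* `isStablyNondegenerate_of_ideal_pair` — **binder-free** form of `CorCM.isStablyNondegenerate_of_ideal_pair_of_hazama`:
  for `X` whose Hodge Lie algebra is the sum of two commuting three-dimensional ideals (neither inside `End_Hdg`),
  `B•(X^{N+1}) = D•(X^{N+1})` for every `N` and the Hodge conjecture holds for every power of `X` — UNCONDITIONALLY.
* `mtRank_hodge_one_eq_seven_trichotomy_hazamaFree` — the COR-CM trichotomy with case (iii) now ending in
  «`IsStablyNondegenerate X ∧ ∀ N, HC(X^{N+1})`» outright (cases (i), (ii) verbatim).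

## References
* [Hazama1989] F. Hazama, Duke Math. J. 58 (1989) 31–37. [cite: Hazama1989, Thm. (= Gordon 7.6.2)]
* [MoonenZarhin1999LowDim] B. Moonen, Yu. Zarhin, Math. Ann. 315 (1999), §1, §2, §3 (3.1), Thm. (3.2)(1), Cor. (3.7).
* [Gordon1999HodgeAVSurvey] B. B. Gordon, *A survey of the Hodge conjecture for abelian varieties*, Thm. 7.5, Thm. 7.6.2.
* [MumfordAV1970] D. Mumford, *Abelian Varieties* (1970), §19 Cor. 1–2 (pp. 173–174), §21 Thm. 2 and table (pp. 201–202).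
* [Deligne1982HodgeCycles] P. Deligne, LNM 900 (1982), I §3 Prop. 3.6.
-/

noncomputable section

open scoped TensorProduct
open CategoryTheory CategoryTheory.Limits Module

namespace Summit.HodgeConjecture.Ring2.MumfordTateRankSevenSplitHazamaFree

open Literature.AlgebraicGeometry.Motives
open Literature.AlgebraicGeometry.Motives.AbelianVariety
open Literature.AlgebraicGeometry.Motives.HodgeStructure
open Literature.AlgebraicGeometry.HodgeTheory
open Literature.AlgebraicGeometry.Milne1999 (IsOfCMType)
open Summit.HodgeConjecture.CorCM

variable [HodgeTensorFacts.{0, 0}] {X : AbelianVariety ℂ} {n : ℕ}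

/-- **Condition (D) and the Hodge conjecture for all powers, for the split shape of the rung `dim MT(H¹X) = 7` —
UNCONDITIONAL** (the binder `Hazama1989_stablyNondegenerate_prod` of `CorCM.isStablyNondegenerate_of_ideal_pair_of_hazama`
discharged by `IsStablyNondegenerate.prod_of_dim_le_seven`, `dim B₂ ≤ 2`). [cite: Hazama1989, Thm. (= Gordon 7.6.2)]
[cite: MoonenZarhin1999LowDim, §3 Thm. (3.2)(1) and Cor. (3.7)] [cite: MumfordAV1970, §21 Thm. 2 and table (pp. 201–202)] -/
theorem isStablyNondegenerate_of_ideal_pair (hX : IsSmoothProjective n X.X)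
    {𝔞 𝔟 : Submodule ℚ (Module.End ℚ (bettiCohomology X.X 1))}
    (h𝔞 : haveI := BettiUniverse.finite hX 1
      𝔞 ≤ (BettiUniverse.hodge exists_isReal_hodgeModel_holds hX 1).hodgeLie)
    (h𝔟 : haveI := BettiUniverse.finite hX 1
      𝔟 ≤ (BettiUniverse.hodge exists_isReal_hodgeModel_holds hX 1).hodgeLie)
    (hI𝔞 : haveI := BettiUniverse.finite hX 1
      ∀ W ∈ (BettiUniverse.hodge exists_isReal_hodgeModel_holds hX 1).hodgeLie, ∀ a ∈ 𝔞, W * a - a * W ∈ 𝔞)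
    (hI𝔟 : haveI := BettiUniverse.finite hX 1
      ∀ W ∈ (BettiUniverse.hodge exists_isReal_hodgeModel_holds hX 1).hodgeLie, ∀ b ∈ 𝔟, W * b - b * W ∈ 𝔟)
    (hcomm : ∀ a ∈ 𝔞, ∀ b ∈ 𝔟, a * b = b * a)
    (hsum : haveI := BettiUniverse.finite hX 1
      (BettiUniverse.hodge exists_isReal_hodgeModel_holds hX 1).hodgeLie ≤ 𝔞 ⊔ 𝔟)
    (h3𝔞 : Module.finrank ℚ 𝔞 = 3) (h3𝔟 : Module.finrank ℚ 𝔟 = 3)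
    (hne𝔞 : haveI := BettiUniverse.finite hX 1
      ¬ 𝔞 ≤ Subalgebra.toSubmodule (BettiUniverse.hodge exists_isReal_hodgeModel_holds hX 1).endAlg)
    (hne𝔟 : haveI := BettiUniverse.finite hX 1
      ¬ 𝔟 ≤ Subalgebra.toSubmodule (BettiUniverse.hodge exists_isReal_hodgeModel_holds hX 1).endAlg) :
    IsStablyNondegenerate X ∧ ∀ N : ℕ, HodgeConjectureFor (X.powSucc N).dim (X.powSucc N).X := by
  obtain ⟨B₁, B₂, a, b, -, hB₂s, -, -, hB₂0, hB₂2, -, hB₂cm, -, -, hfin₂, hZ₂, -, -, -, hXB, -, -, -, hSN₁, hSN₂, -, -⟩ :=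
    exists_shape_and_hodge_of_ideal_pair hX h𝔞 h𝔟 hI𝔞 hI𝔟 hcomm hsum h3𝔞 h3𝔟 hne𝔞 hne𝔟
  obtain ⟨hA4₂, -, -⟩ := hasNoTypeIVFactor_and_isStablyNondegenerate_of_factor hB₂s hB₂0 hB₂2 hB₂cm hfin₂ hZ₂
  have hSN : IsStablyNondegenerate X :=
    ((hSN₁.prod_of_dim_le_seven hSN₂ hA4₂ (by omega)).powSucc_prod_powSucc a b).of_isIsogenous hXB
  exact ⟨hSN, hSN.hodgeConjectureFor_powSucc⟩

/-- **The rung `dim MT(H¹(X)) = 7`, `X` NOT of CM type: the trichotomy, with case (iii) UNCONDITIONAL** (verbatim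
`CorCM.mtRank_hodge_one_eq_seven_trichotomy`, its last two conjuncts — the curves-only sub-case and the Hazama-conditional
sub-case — replaced by «`X` is stably nondegenerate and the Hodge conjecture holds for every power of `X`»).
[cite: MoonenZarhin1999LowDim, §1, §2, §3 (3.1), Thm. (3.2) and Cor. (3.7)] [cite: Deligne1982HodgeCycles, I §3 Prop. 3.6]
[cite: Hazama1989, Thm. (= Gordon 7.6.2)] -/
theorem mtRank_hodge_one_eq_seven_trichotomy_hazamaFree (hX : IsSmoothProjective n X.X) (h0 : 0 < X.dim)
    (hcm : ¬ IsOfCMType X)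
    (h7 : haveI := BettiUniverse.finite hX 1
      (BettiUniverse.hodge exists_isReal_hodgeModel_holds hX 1).mtRank = 7) :
    haveI := BettiUniverse.finite hX 1
    letI : LieRing (Module.End ℚ (bettiCohomology X.X 1)) := LieRing.ofAssociativeRing
    (Module.finrank ℚ ↥(Submodule.span ℚ {B | ∃ X' ∈ (BettiUniverse.hodge exists_isReal_hodgeModel_holds hX 1).hodgeLie,
        ∃ Y ∈ (BettiUniverse.hodge exists_isReal_hodgeModel_holds hX 1).hodgeLie, X' * Y - Y * X' = B}) = 3 ∧
      (IsStablyNondegenerate X ∨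
        ∃ (B Z : AbelianVariety ℂ) (m : ℕ), B.IsSimple ∧ 0 < B.dim ∧ B.dim ≤ 2 ∧ ¬ IsOfCMType B ∧
          Module.finrank ℚ B.endAlgebra = B.dim ^ 2 ∧ IsOfCMType Z ∧ IsIsogenous X ((B.powSucc m).prod Z) ∧
          (m + 1) * B.dim + Z.dim = X.dim ∧ 0 < Z.dim ∧
          (haveI := BettiUniverse.finite (AbelianVariety.isSmoothProjective_holds (A := Z)) 1
           (BettiUniverse.hodge exists_isReal_hodgeModel_holds (AbelianVariety.isSmoothProjective_holds (A := Z)) 1).mtRank = 4) ∧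
          ¬ ∀ N : ℕ, IsDivisorGenerated (Z.powSucc N)) ∧
      (Markman2025_weilClasses_algebraic_abelianFourfold → ∀ N : ℕ, HodgeConjectureFor (X.powSucc N).dim (X.powSucc N).X)) ∨
    ((BettiUniverse.hodge exists_isReal_hodgeModel_holds hX 1).hodgeLie ⊓
        Subalgebra.toSubmodule (BettiUniverse.hodge exists_isReal_hodgeModel_holds hX 1).endAlg = ⊥ ∧
      ∀ 𝔏 : LieSubalgebra ℚ (Module.End ℚ (bettiCohomology X.X 1)),
        𝔏.toSubmodule = (BettiUniverse.hodge exists_isReal_hodgeModel_holds hX 1).hodgeLie → LieAlgebra.IsSimple ℚ 𝔏) ∨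
    ((BettiUniverse.hodge exists_isReal_hodgeModel_holds hX 1).hodgeLie ⊓
        Subalgebra.toSubmodule (BettiUniverse.hodge exists_isReal_hodgeModel_holds hX 1).endAlg = ⊥ ∧
      ∃ (B₁ B₂ : AbelianVariety ℂ) (a b : ℕ), B₁.IsSimple ∧ B₂.IsSimple ∧ 0 < B₁.dim ∧ B₁.dim ≤ 2 ∧ 0 < B₂.dim ∧
        B₂.dim ≤ 2 ∧ ¬ IsOfCMType B₁ ∧ ¬ IsOfCMType B₂ ∧
        Module.finrank ℚ B₁.endAlgebra = B₁.dim ^ 2 ∧ Module.finrank ℚ (Subalgebra.center ℚ B₁.endAlgebra) = 1 ∧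
        Module.finrank ℚ B₂.endAlgebra = B₂.dim ^ 2 ∧ Module.finrank ℚ (Subalgebra.center ℚ B₂.endAlgebra) = 1 ∧
        (∀ f : B₁ ⟶ B₂, f = 0) ∧ (∀ f : B₂ ⟶ B₁, f = 0) ∧ ¬ IsIsogenous B₁ B₂ ∧
        IsIsogenous X ((B₁.powSucc a).prod (B₂.powSucc b)) ∧ (a + 1) * B₁.dim + (b + 1) * B₂.dim = X.dim ∧
        HasNoTypeIVFactor X ∧ IsStablyNondegenerate B₁ ∧ IsStablyNondegenerate B₂ ∧
        IsStablyNondegenerate X ∧ ∀ N : ℕ, HodgeConjectureFor (X.powSucc N).dim (X.powSucc N).X) := by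
  haveI := BettiUniverse.finite hX 1
  letI : LieRing (Module.End ℚ (bettiCohomology X.X 1)) := LieRing.ofAssociativeRing
  rcases mtRank_hodge_one_eq_seven_trichotomy hX h0 hcm h7 with h | h | ⟨hz, B₁, B₂, a, b, hB₁s, hB₂s, hB₁0, hB₁2, hB₂0,
      hB₂2, hB₁cm, hB₂cm, hfin₁, hZ₁, hfin₂, hZ₂, h12, h21, hniso, hXB, hdim, hA4, hSN₁, hSN₂, -, -⟩
  · exact Or.inl h
  · exact Or.inr (Or.inl h)
  · obtain ⟨hA4₂, -, -⟩ := hasNoTypeIVFactor_and_isStablyNondegenerate_of_factor hB₂s hB₂0 hB₂2 hB₂cm hfin₂ hZ₂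
    have hSN : IsStablyNondegenerate X :=
      ((hSN₁.prod_of_dim_le_seven hSN₂ hA4₂ (by omega)).powSucc_prod_powSucc a b).of_isIsogenous hXB
    exact Or.inr (Or.inr ⟨hz, B₁, B₂, a, b, hB₁s, hB₂s, hB₁0, hB₁2, hB₂0, hB₂2, hB₁cm, hB₂cm, hfin₁, hZ₁, hfin₂, hZ₂, h12,
      h21, hniso, hXB, hdim, hA4, hSN₁, hSN₂, hSN, hSN.hodgeConjectureFor_powSucc⟩)

end Summit.HodgeConjecture.Ring2.MumfordTateRankSevenSplitHazamaFree

end
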